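import Literature.NumberTheory.EllipticCurves.FormalGroupHasseInvariantProofs
import Literature.NumberTheory.EllipticCurves.FormalGroupShortModelParityProofs
import Mathlib.Algebra.Polynomial.Div
import Mathlib.Algebra.Polynomial.Derivative
import HarnessLib

/-!
# The approximants `ζ_N` of the `p`-adic Weierstrass zeta function (Blakestad–Grant 2023, §2.1:
# Prop. 3 and its congruence `Dζ_n ≡ -x + βₙ (mod pⁿ)`), made explicit

Trunk T-NT-EC (Literature/NumberTheory/EllipticCurves). First file of this seat's formalisation of
Blakestad–Grant's construction of the universal `p`-adic Weierstrass ZETA function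
(J. Number Theory 249 (2023), §2.1, Thm. 2: for `y² = f(x)` over a `p`-complete ring in which the
Hasse lift `H` is a unit there are a unique `β` and a unique odd `ζ ∈ 1/t + R̂⟦t⟧` with
`D ζ = -x + β`, `D = d/ω`), which is the first half (the Mazur–Tate CONSTANT `c = -β` and the
integrality of `Dσ/σ`) of the existence of the Mazur–Tate sigma function (tree fact
`WeierstrassCurve.mazur_tate_sigma_existsUnique`; Mazur–Stein–Tate 2006 Thm. 1.3). The sequel
`PadicWeierstrassZeta.lean` passes to the `p`-adic limit.

For a Weierstrass model with `a₁ = a₃ = 0` (`y² = f(x) = x³ + a₂x² + a₄x + a₆`, Mathlib's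
`IsCharNeTwoNF`) and an odd `N = 2m + 1`, Blakestad–Grant's function `z_N ∈ L(N·O)` (Prop. 3(a):
the unique function with only a pole at `O`, expansion `t^{-N} - H_N/t - J_N t + ⋯`) and their
`ζ_N = H_N⁻¹(t^{-N} - z_N)` are EXPLICIT: since `t = -x/y` and `y^N = y·f(x)^m`,

  `t^{-N} = -y·f(x)^m/x^N = -y·Q_N(x) + H_N·(1/t) + O(t)`,  `f^m = T_N + x^N Q_N` (`deg T_N < N`),

so `z_N = -y·Q_N(x)`, `H_N = [x^{N-1}] f^m`, `J_N = [x^{N-2}] f^m` (Blakestad–Grant's remark "`H` and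
`H₁` are the same"), and `ζ_N = -H_N⁻¹·y·T_N(x)/x^N`, i.e. `t·ζ_N = H_N⁻¹·B^{N-1}·ev_{N-1}(T_N)`
with `B = w/z³ = 1/(z²x)` and `ev_d(g) = z^{2d}g(x)` (the tree's `evalXZsq ∘ homogenize`). The
congruence of Prop. 3(c), `D z_N ≡ H_N x - J_N`, i.e. `D ζ_N ≡ -x + J_N/H_N (mod N)`, then has a
three-line proof: on functions `y·g(x)` the invariant derivation is `D(y·g(x)) = L(g)`,
`L(g) := f'g + 2f g'`, and `L(f^m) = D(y^{2m+1}) = N·f'·f^m ≡ 0 (mod N)`; splitting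
`f^m = T_N + x^N Q_N` gives the exact identity

  `L(T_N) + x^N·L(Q_N) = N·(f'·f^m - 2x^{N-1}·f·Q_N)`        (`zetaOp_core`)

and since `deg L(T_N) ≤ N + 1`, all coefficients of `L(Q_N)` are `≡ 0 (mod N)` except
`[x¹]L(Q_N) ≡ -H_N`, `[x⁰]L(Q_N) ≡ J_N` (`coeff_zetaOp_divX_sub_mem`).

Main results (`R` any commutative ring; `[W.IsCharNeTwoNF]` where stated):

* `rhsCubic W = f`, `zetaOp W g = L(g) = f'g + 2fg'`, `zetaOp_pow_rhsCubic` (`L(f^m) = N f' f^m`),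
  `zetaOp_core`, `coeff_zetaOp_divX_sub_mem` (polynomial algebra, no hypothesis on `W`);
* `clearedEval W d g = ev_d(g) = z^{2d} g(x)` (`= evalXZsq (homogenize g d)`), its algebra, and
  `clearedEval_pow_rhsCubic : ev_{3m}(f^m) = X^{2m}` (`X = z²x = formalXMulSq`; the Weierstrass
  equation `X² = z⁶f(x) = ev₃(f)`);
* `clearedDeriv W M F = η·(zF' - M·F)` — the invariant derivation on `z^{-M}R⟦z⟧` with the pole
  cleared (`z^{M+1}·D(z^{-M}F)`, `D = η·d/dz = formalInvariantDerivation`), and the dictionary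
  `clearedDeriv_clearedEval` : **`D(y·g(x)) = L(g)`** in the form
  `𝒟_{2e+3}(ev_{e+1}(x·g)) = -ev_{e+2}(L g)` (`deg g ≤ e`);
* `zetaApproxNum W m = B^{N-1}·ev_{N-1}(T_N) = H_N·t·ζ_N` (`N = 2m+1`) with
  `one_sub_clearedEval_eq` : `1 - ev_m(x·Q_N) = t^{N-1}·zetaApproxNum` (i.e.
  `t^{-N} - z_N = H_N ζ_N`, poles cleared), `constantCoeff_zetaApproxNum = H_N`, and
  **`coeff_clearedDeriv_zetaApproxNum_sub_mem`** : `𝒟₁(H_N tζ_N) ≡ -H_N·X + J_N·t² (mod N)`, the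
  pole-cleared form of Blakestad–Grant's Prop. 3(c) `D ζ_N ≡ -x + β_N (mod N)`,
  `β_N = J_N/H_N = [x^{N-2}]f^m / [x^{N-1}]f^m`.

## Sources

* C. Blakestad, D. Grant, *On the universal `p`-adic sigma and Weierstrass zeta functions*,
  J. Number Theory 249 (2023) 348–376 (arXiv:1903.02480), §2.1: Prop. 3 (a)(b)(c) and proof,
  Remark after Prop. 3 (`H = H₁`, [Has], [SB]), Lemma 4, Thm. 2. [BlakestadGrant2023]
* B. Mazur, W. Stein, J. Tate, *Computation of `p`-adic heights and log convergence*, Doc. Math.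
  Extra Vol. Coates (2006), Thm. 1.3 and (1.7) (the constant `c`; `c = -β`). [MazurSteinTate2006]
* J. H. Silverman, *AEC* 2nd ed. (2009), IV.1 (`t = -x/y`, the expansions of `x`, `y`, `ω`).

## Design notes

* Everything is an identity of polynomials in `x` or of honest power series in `z` (poles cleared
  by powers of `z`); congruences modulo `N` are membership of all coefficients in
  `Ideal.span {(N : R)}`. No `p`, no completeness here: `N` is any odd number `≥ 3`.
* Definitions introduced (all with bodies): `rhsCubic`, `zetaOp`, `clearedEval`, `clearedDeriv`,
  `zetaRem`, `zetaQuot`, `zetaApproxNum`. No named fact; nothing is asserted without proof.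
* Relation to `PadicWeierstrassZetaProofs.lean` (Blakestad–Grant Thm. 2 by their own route:
  triangular elimination for `z_K`, residue lemma, unitriangularity; not imported — two of its
  elementary identities are re-derived here as private lemmas): the present file makes `z_K`,
  `H_K`, `J_K` and `ζ_K` EXPLICIT and proves Prop. 3(c) through `L`; the sequel
  `PadicSigmaConstantFormulaProofs.lean` combines both to the closed formula
  `β ≡ [x^{N-2}]f^m / [x^{N-1}]f^m (mod N)` for the constant `β` (`= -c`, the Mazur–Tate
  constant).
-/

noncomputable section

namespace WeierstrassCurve

section PolynomialAlgebra

open Polynomial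

variable {R : Type*} [CommRing R] (W : WeierstrassCurve R)

/-! ### The cubic `f` and the operator `L(g) = f'g + 2fg'` -/

/-- `f(x) = x³ + a₂x² + a₄x + a₆`, the right-hand side of a Weierstrass equation with
`a₁ = a₃ = 0`. [Blakestad–Grant 2023, §2 eq. (1) (`y² = f(x)`)] [cite: BlakestadGrant2023, §2] -/
def rhsCubic : R[X] :=
  X ^ 3 + C W.a₂ * X ^ 2 + C W.a₄ * X + C W.a₆

/-- **The operator `L(g) = f'·g + 2f·g'`**: for the invariant derivation `D = d/ω`, `ω = dx/2y`,
of `y² = f(x)` one has `Dx = 2y`, `Dy = f'(x)`, hence `D(y·g(x)) = f'(x)g(x) + 2f(x)g'(x)`.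
[Blakestad–Grant 2023, §2 ("`D` … the unique derivation such that `Dx = 2y`")]
[cite: BlakestadGrant2023, §2] -/
def zetaOp (g : R[X]) : R[X] :=
  derivative W.rhsCubic * g + 2 * W.rhsCubic * derivative g

/-- Unfolding `rhsCubic`. [folklore] -/
theorem rhsCubic_def : W.rhsCubic = X ^ 3 + C W.a₂ * X ^ 2 + C W.a₄ * X + C W.a₆ := rfl

/-- `rhsCubic` with all monomials written `C _ * X ^ _`. [folklore] -/
theorem rhsCubic_eq :
    W.rhsCubic = C 1 * X ^ 3 + C W.a₂ * X ^ 2 + C W.a₄ * X ^ 1 + C W.a₆ * X ^ 0 := by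
  rw [rhsCubic_def, map_one, one_mul, pow_one, pow_zero, mul_one]

/-- `f' = 3x² + 2a₂x + a₄`. [folklore] -/
theorem derivative_rhsCubic :
    derivative W.rhsCubic = C 3 * X ^ 2 + C (2 * W.a₂) * X ^ 1 + C W.a₄ * X ^ 0 := by
  rw [rhsCubic_def]
  simp only [derivative_add, derivative_mul, derivative_X_pow, derivative_C, derivative_X, map_mul,
    zero_mul, zero_add, mul_one, pow_one, pow_zero]
  push_cast
  simp only [map_ofNat]
  ring

/-- `deg f ≤ 3`. [folklore] -/
theorem natDegree_rhsCubic_le : W.rhsCubic.natDegree ≤ 3 := by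
  rw [rhsCubic_def, ← one_mul (X ^ 3 : R[X]), ← C_1]
  exact natDegree_cubic_le

/-- `deg f' ≤ 2`. [folklore] -/
theorem natDegree_derivative_rhsCubic_le : (derivative W.rhsCubic).natDegree ≤ 2 := by
  rw [derivative_rhsCubic, pow_one, pow_zero, mul_one]
  exact natDegree_quadratic_le

/-- `f` is monic. [folklore] -/
theorem monic_rhsCubic : W.rhsCubic.Monic := by
  nontriviality R
  rw [rhsCubic_def, ← one_mul (X ^ 3 : R[X]), ← C_1]
  exact leadingCoeff_cubic one_ne_zero

/-- `deg f^m = 3m` over a nontrivial ring. [folklore] -/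
theorem natDegree_rhsCubic_pow [Nontrivial R] (m : ℕ) : (W.rhsCubic ^ m).natDegree = 3 * m := by
  rw [W.monic_rhsCubic.natDegree_pow, mul_comm]
  congr 1
  rw [rhsCubic_def, ← one_mul (X ^ 3 : R[X]), ← C_1]
  exact natDegree_cubic one_ne_zero

/-- A coefficient extraction: `[x^n](c·x^k·T) = c·[x^{n-k}]T` for `k ≤ n`. [folklore] -/
theorem _root_.Literature.NumberTheory.EllipticCurves.coeff_C_mul_X_pow_mul {c : R} {k n : ℕ}
    (T : R[X]) (h : k ≤ n) : (C c * X ^ k * T).coeff n = c * T.coeff (n - k) := by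
  rw [mul_assoc, coeff_C_mul, coeff_X_pow_mul', if_pos h]

/-- A coefficient extraction: `[x^n](c·x^k·T) = 0` for `n < k`. [folklore] -/
theorem _root_.Literature.NumberTheory.EllipticCurves.coeff_C_mul_X_pow_mul_of_lt {c : R} {k n : ℕ}
    (T : R[X]) (h : n < k) : (C c * X ^ k * T).coeff n = 0 := by
  rw [mul_assoc, coeff_C_mul, coeff_X_pow_mul', if_neg (by omega), mul_zero]

open Literature.NumberTheory.EllipticCurves in
/-- `[x³] f = 1`. [folklore] -/
theorem coeff_rhsCubic_three : W.rhsCubic.coeff 3 = 1 := by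
  simp [rhsCubic, coeff_X_pow, coeff_C_mul]

open Literature.NumberTheory.EllipticCurves in
/-- `[x²] f' = 3`. [folklore] -/
theorem coeff_derivative_rhsCubic_two : (derivative W.rhsCubic).coeff 2 = 3 := by
  rw [derivative_rhsCubic]
  simp

/-- Unfolding `zetaOp`. [folklore] -/
theorem zetaOp_def (g : R[X]) :
    W.zetaOp g = derivative W.rhsCubic * g + 2 * W.rhsCubic * derivative g := rfl

/-- `L` is additive. [folklore] -/
theorem zetaOp_add (g h : R[X]) : W.zetaOp (g + h) = W.zetaOp g + W.zetaOp h := by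
  simp only [zetaOp, derivative_add]; ring

/-- `L` commutes with scalars. [folklore] -/
theorem zetaOp_C_mul (c : R) (g : R[X]) : W.zetaOp (C c * g) = C c * W.zetaOp g := by
  simp only [zetaOp, derivative_mul, derivative_C, zero_mul, zero_add]; ring

/-- `L(-g) = -L(g)`. [folklore] -/
theorem zetaOp_neg (g : R[X]) : W.zetaOp (-g) = -W.zetaOp g := by
  simp only [zetaOp, derivative_neg]; ring

/-- `L(g - h) = L g - L h`. [folklore] -/
theorem zetaOp_sub (g h : R[X]) : W.zetaOp (g - h) = W.zetaOp g - W.zetaOp h := by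
  rw [sub_eq_add_neg, zetaOp_add, zetaOp_neg, ← sub_eq_add_neg]

/-- `L(0) = 0`. [folklore] -/
@[simp] theorem zetaOp_zero : W.zetaOp 0 = 0 := by
  simp [zetaOp]

/-- `L(Σ gᵢ) = Σ L(gᵢ)`. [folklore] -/
theorem zetaOp_sum {ι : Type*} (s : Finset ι) (g : ι → R[X]) :
    W.zetaOp (∑ i ∈ s, g i) = ∑ i ∈ s, W.zetaOp (g i) := by
  classical
  induction s using Finset.induction_on with
  | empty => simp
  | insert a s ha ih => rw [Finset.sum_insert ha, Finset.sum_insert ha, zetaOp_add, ih]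

/-- Leibniz for `L`: `L(g·h) = L(g)·h + 2f·g·h'`. [folklore] -/
theorem zetaOp_mul (g h : R[X]) :
    W.zetaOp (g * h) = W.zetaOp g * h + 2 * W.rhsCubic * g * derivative h := by
  simp only [zetaOp, derivative_mul]; ring

/-- **`L(f^m) = (2m+1)·f'·f^m`** (on the curve: `D(y^{2m+1}) = (2m+1)·y^{2m}·Dy`).
[Blakestad–Grant 2023, §2] [folklore] -/
theorem zetaOp_pow_rhsCubic (m : ℕ) :
    W.zetaOp (W.rhsCubic ^ m) = (2 * (m : R[X]) + 1) * (derivative W.rhsCubic * W.rhsCubic ^ m) := by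
  rcases m with _ | m
  · simp [zetaOp]
  · rw [zetaOp, derivative_pow_succ, map_add, map_natCast, map_one]
    push_cast
    ring

/-- `L(x^N) = f'·x^N + 2N·f·x^{N-1}` (for `N ≥ 1`, written with `N = n + 1`). [folklore] -/
theorem zetaOp_X_pow_succ (n : ℕ) :
    W.zetaOp (X ^ (n + 1)) =
      derivative W.rhsCubic * X ^ (n + 1) + 2 * ((n : R[X]) + 1) * W.rhsCubic * X ^ n := by
  rw [zetaOp, derivative_X_pow, Nat.add_sub_cancel, map_natCast]
  push_cast
  ring

/-! ### The core identity and the congruence for `L(Q_N)` -/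

/-- **Core identity.** If `f^m = T + x^N·Q` with `N = 2m + 1`, then
`L(T) + x^N·L(Q) = N·(f'·f^m - 2x^{N-1}·f·Q)`. (On the curve, with `z_N = -yQ(x)`,
`H_Nζ_N = -y·T(x)/x^N`: `D(y f^m/x^N) = D(y^N/x^N) = D(t^{-N}) ≡ 0 (mod N)`.)
[Blakestad–Grant 2023, Prop. 3(c) (proof)] [cite: BlakestadGrant2023, Prop. 3] -/
theorem zetaOp_core {m : ℕ} {T Q : R[X]} (h : T + X ^ (2 * m + 1) * Q = W.rhsCubic ^ m) :
    W.zetaOp T + X ^ (2 * m + 1) * W.zetaOp Q =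
      (2 * (m : R[X]) + 1) * (derivative W.rhsCubic * W.rhsCubic ^ m -
        2 * X ^ (2 * m) * W.rhsCubic * Q) := by
  have hL := W.zetaOp_pow_rhsCubic m
  rw [← h, zetaOp_add, zetaOp_mul, W.zetaOp_X_pow_succ (2 * m), h] at hL
  have hzQ : W.zetaOp Q = derivative W.rhsCubic * Q + 2 * W.rhsCubic * derivative Q := rfl
  push_cast at hL
  linear_combination hL + X ^ (2 * m + 1) * hzQ

/-- `deg L(T) ≤ deg T + 2`. [folklore] -/
theorem natDegree_zetaOp_le (T : R[X]) : (W.zetaOp T).natDegree ≤ T.natDegree + 2 := by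
  rw [zetaOp]
  refine (natDegree_add_le _ _).trans (max_le ?_ ?_)
  · refine natDegree_mul_le.trans ?_
    have := W.natDegree_derivative_rhsCubic_le
    omega
  · by_cases hT : T.natDegree = 0
    · rw [derivative_of_natDegree_zero hT, mul_zero, natDegree_zero]; exact Nat.zero_le _
    · rw [mul_assoc, show (2 : R[X]) = C 2 from (map_ofNat C 2).symm]
      refine (natDegree_C_mul_le _ _).trans (natDegree_mul_le.trans ?_)
      have h1 := W.natDegree_rhsCubic_le
      have h3 := natDegree_derivative_le T
      omega

/-- The coefficients of `L(Q)` of degree `≥ 2` are divisible by `N`: compare degrees `N + k` in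
the core identity (`deg L(T) ≤ N + 1`). [Blakestad–Grant 2023, Prop. 3(c)]
[cite: BlakestadGrant2023, Prop. 3] -/
theorem coeff_zetaOp_divX_mem_of_two_le {m : ℕ} {T Q : R[X]}
    (h : T + X ^ (2 * m + 1) * Q = W.rhsCubic ^ m) (hT : T.natDegree ≤ 2 * m) {k : ℕ} (hk : 2 ≤ k) :
    (W.zetaOp Q).coeff k ∈ Ideal.span {(2 * (m : R) + 1)} := by
  have hcore := congrArg (fun P : R[X] => P.coeff (k + (2 * m + 1))) (W.zetaOp_core h)
  simp only [coeff_add, coeff_X_pow_mul] at hcore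
  have hLT : (W.zetaOp T).coeff (k + (2 * m + 1)) = 0 := by
    refine coeff_eq_zero_of_natDegree_lt ?_
    have := W.natDegree_zetaOp_le T
    omega
  have hC : C (2 * (m : R) + 1) = 2 * (m : R[X]) + 1 := by
    rw [map_add, map_mul, map_ofNat, map_natCast, map_one]
  rw [hLT, zero_add, ← hC, coeff_C_mul] at hcore
  rw [hcore]
  exact Ideal.mul_mem_right _ _ (Ideal.subset_span rfl)

/-- Coefficients of the remainder and of `f^m` agree below degree `N`. [folklore] -/
theorem _root_.Literature.NumberTheory.EllipticCurves.coeff_eq_of_add_X_pow_mul {N : ℕ}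
    {T Q P : R[X]} (h : T + X ^ N * Q = P) {j : ℕ} (hj : j < N) : T.coeff j = P.coeff j := by
  have := congrArg (fun F : R[X] => F.coeff j) h
  simp only [coeff_add, coeff_X_pow_mul', if_neg (show ¬ N ≤ j by omega), add_zero] at this
  exact this

/-- `((n - 1 : ℕ) : R) + 1 = n` for `1 ≤ n`. [folklore] -/
theorem _root_.Literature.NumberTheory.EllipticCurves.natCast_pred_add_one {n : ℕ} (hn : 1 ≤ n) :
    ((n - 1 : ℕ) : R) + 1 = n := by
  conv_rhs => rw [← Nat.sub_add_cancel hn]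
  push_cast
  ring

open Literature.NumberTheory.EllipticCurves in
/-- The degree-`N+1` coefficient of `L(T)`: `[x^{N+1}]L(T) = (2N+1)·[x^{N-1}]T` for `deg T ≤ N - 1`,
`N = 2m + 1`. [folklore] -/
theorem coeff_zetaOp_top {m : ℕ} (hm : 1 ≤ m) {T : R[X]} (hT : T.natDegree ≤ 2 * m) :
    (W.zetaOp T).coeff (2 * m + 2) = (4 * (m : R) + 3) * T.coeff (2 * m) := by
  rw [zetaOp, coeff_add]
  have h1 : (derivative W.rhsCubic * T).coeff (2 * m + 2) = 3 * T.coeff (2 * m) := by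
    rw [show 2 * m + 2 = 2 + 2 * m by ring,
      coeff_mul_add_eq_of_natDegree_le W.natDegree_derivative_rhsCubic_le hT,
      coeff_derivative_rhsCubic_two]
  have h2 : (W.rhsCubic * derivative T).coeff (2 * m + 2) = 2 * (m : R) * T.coeff (2 * m) := by
    have hT' : (derivative T).natDegree ≤ 2 * m - 1 := (natDegree_derivative_le T).trans (by omega)
    rw [show 2 * m + 2 = 3 + (2 * m - 1) by omega,
      coeff_mul_add_eq_of_natDegree_le W.natDegree_rhsCubic_le hT', coeff_rhsCubic_three, one_mul,
      coeff_derivative, show 2 * m - 1 + 1 = 2 * m by omega, natCast_pred_add_one (by omega)]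
    push_cast
    ring
  rw [h1, mul_assoc (2 : R[X]), show (2 : R[X]) = C 2 from (map_ofNat C 2).symm, coeff_C_mul, h2]
  ring

open Literature.NumberTheory.EllipticCurves in
/-- The degree-`N` coefficient of `L(T)`: `[x^N]L(T) = (2N-1)·[x^{N-2}]T + 2N·a₂·[x^{N-1}]T` for
`deg T ≤ N - 1`, `N = 2m + 1`. [folklore] -/
theorem coeff_zetaOp_subtop {m : ℕ} (hm : 1 ≤ m) {T : R[X]} (hT : T.natDegree ≤ 2 * m) :
    (W.zetaOp T).coeff (2 * m + 1) =
      (4 * (m : R) + 1) * T.coeff (2 * m - 1) + (4 * (m : R) + 2) * W.a₂ * T.coeff (2 * m) := by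
  have hTN : T.coeff (2 * m + 1) = 0 := coeff_eq_zero_of_natDegree_lt (by omega)
  have hTN' : T.coeff (2 * m + 2) = 0 := coeff_eq_zero_of_natDegree_lt (by omega)
  have hd : ∀ j, (derivative T).coeff j = T.coeff (j + 1) * (j + 1) := coeff_derivative T
  -- `f'·T`
  have h1 : (derivative W.rhsCubic * T).coeff (2 * m + 1) =
      3 * T.coeff (2 * m - 1) + 2 * W.a₂ * T.coeff (2 * m) := by
    rw [derivative_rhsCubic, add_mul, add_mul, coeff_add, coeff_add,
      coeff_C_mul_X_pow_mul _ (by omega), coeff_C_mul_X_pow_mul _ (by omega),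
      coeff_C_mul_X_pow_mul _ (by omega), show 2 * m + 1 - 2 = 2 * m - 1 by omega,
      show 2 * m + 1 - 1 = 2 * m by omega, Nat.sub_zero, hTN]
    ring
  -- `f·T'`
  have h2 : (W.rhsCubic * derivative T).coeff (2 * m + 1) =
      (2 * (m : R) - 1) * T.coeff (2 * m - 1) + 2 * (m : R) * W.a₂ * T.coeff (2 * m) := by
    rw [rhsCubic_eq, add_mul, add_mul, add_mul, coeff_add, coeff_add, coeff_add,
      coeff_C_mul_X_pow_mul _ (by omega), coeff_C_mul_X_pow_mul _ (by omega),
      coeff_C_mul_X_pow_mul _ (by omega), coeff_C_mul_X_pow_mul _ (by omega),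
      show 2 * m + 1 - 3 = 2 * m - 2 by omega, show 2 * m + 1 - 2 = 2 * m - 1 by omega,
      show 2 * m + 1 - 1 = 2 * m by omega, Nat.sub_zero, hd, hd, hd, hd,
      show 2 * m - 2 + 1 = 2 * m - 1 by omega, show 2 * m - 1 + 1 = 2 * m by omega, hTN,
      show 2 * m + 1 + 1 = 2 * m + 2 by ring, hTN']
    have e1 : ((2 * m - 2 : ℕ) : R) + 1 = 2 * (m : R) - 1 := by
      have : ((2 * m - 1 : ℕ) : R) + 1 = 2 * (m : R) := by
        rw [natCast_pred_add_one (show 1 ≤ 2 * m by omega)]; push_cast; ring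
      rw [show 2 * m - 2 = (2 * m - 1) - 1 by omega, natCast_pred_add_one (show 1 ≤ 2 * m - 1 by omega)]
      linear_combination this
    have e2 : ((2 * m - 1 : ℕ) : R) + 1 = 2 * (m : R) := by
      rw [natCast_pred_add_one (show 1 ≤ 2 * m by omega)]; push_cast; ring
    rw [e1, e2]
    ring
  rw [zetaOp, coeff_add, h1, mul_assoc (2 : R[X]), show (2 : R[X]) = C 2 from (map_ofNat C 2).symm,
    coeff_C_mul, h2]
  ring

/-- **`L(Q_N) ≡ J_N - H_N·x (mod N)`**, coefficientwise: for `f^m = T + x^N Q`, `N = 2m + 1 ≥ 3`,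
`deg T < N`, `H_N = [x^{N-1}]f^m`, `J_N = [x^{N-2}]f^m`, every coefficient of
`L(Q) - (J_N - H_N x)` lies in `N·R`. Equivalently `D z_N ≡ H_N x - J_N (mod N)` for
`z_N = -y Q(x)`. [Blakestad–Grant 2023, Prop. 3(c) ("`a_n = H_n` and `b_n = -J_n mod pⁿ`")]
[cite: BlakestadGrant2023, Prop. 3] -/
theorem coeff_zetaOp_divX_sub_mem {m : ℕ} (hm : 1 ≤ m) {T Q : R[X]}
    (h : T + X ^ (2 * m + 1) * Q = W.rhsCubic ^ m) (hT : T.natDegree ≤ 2 * m) (k : ℕ) :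
    (W.zetaOp Q - (C ((W.rhsCubic ^ m).coeff (2 * m - 1)) -
      C ((W.rhsCubic ^ m).coeff (2 * m)) * X)).coeff k ∈ Ideal.span {(2 * (m : R) + 1)} := by
  have hH : T.coeff (2 * m) = (W.rhsCubic ^ m).coeff (2 * m) :=
    Literature.NumberTheory.EllipticCurves.coeff_eq_of_add_X_pow_mul h (by omega)
  have hJ : T.coeff (2 * m - 1) = (W.rhsCubic ^ m).coeff (2 * m - 1) :=
    Literature.NumberTheory.EllipticCurves.coeff_eq_of_add_X_pow_mul h (by omega)
  have mem : ∀ r : R, (2 * (m : R) + 1) * r ∈ Ideal.span {(2 * (m : R) + 1)} := fun r =>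
    Ideal.mul_mem_right _ _ (Ideal.subset_span rfl)
  have hC : C (2 * (m : R) + 1) = 2 * (m : R[X]) + 1 := by
    rw [map_add, map_mul, map_ofNat, map_natCast, map_one]
  rcases Nat.lt_or_ge k 2 with hk | hk
  · have hcore := W.zetaOp_core h
    rw [← hC] at hcore
    interval_cases k
    · -- constant coefficient: compare degree `N`
      have hc := congrArg (fun P : R[X] => P.coeff (2 * m + 1)) hcore
      simp only [coeff_add, coeff_C_mul, coeff_X_pow_mul', if_pos le_rfl, Nat.sub_self] at hc
      rw [W.coeff_zetaOp_subtop hm hT, hH, hJ] at hc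
      simp only [coeff_sub, coeff_C_zero, coeff_C_mul, coeff_X_zero, mul_zero, sub_zero]
      set c := (derivative W.rhsCubic * W.rhsCubic ^ m -
        2 * X ^ (2 * m) * W.rhsCubic * Q).coeff (2 * m + 1)
      have : (W.zetaOp Q).coeff 0 - (W.rhsCubic ^ m).coeff (2 * m - 1) =
          (2 * (m : R) + 1) * (c - 2 * (W.rhsCubic ^ m).coeff (2 * m - 1) -
            2 * W.a₂ * (W.rhsCubic ^ m).coeff (2 * m)) := by
        linear_combination hc
      rw [this]
      exact mem _
    · -- linear coefficient: compare degree `N + 1`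
      have hc := congrArg (fun P : R[X] => P.coeff (2 * m + 2)) hcore
      simp only [coeff_add, coeff_C_mul, coeff_X_pow_mul', if_pos (show 2 * m + 1 ≤ 2 * m + 2 by omega),
        show 2 * m + 2 - (2 * m + 1) = 1 by omega] at hc
      rw [W.coeff_zetaOp_top hm hT, hH] at hc
      simp only [coeff_sub, coeff_C, if_neg one_ne_zero, coeff_C_mul, coeff_X_one, mul_one,
        zero_sub, sub_neg_eq_add]
      set c := (derivative W.rhsCubic * W.rhsCubic ^ m -
        2 * X ^ (2 * m) * W.rhsCubic * Q).coeff (2 * m + 2)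
      have : (W.zetaOp Q).coeff 1 + (W.rhsCubic ^ m).coeff (2 * m) =
          (2 * (m : R) + 1) * (c - 2 * (W.rhsCubic ^ m).coeff (2 * m)) := by
        linear_combination hc
      rw [this]
      exact mem _
  · have h0 : (C ((W.rhsCubic ^ m).coeff (2 * m - 1)) -
        C ((W.rhsCubic ^ m).coeff (2 * m)) * X : R[X]).coeff k = 0 := by
      rw [coeff_sub, coeff_C, if_neg (by omega), coeff_C_mul, coeff_X, if_neg (by omega), mul_zero,
        sub_zero]
    rw [coeff_sub, h0, sub_zero]
    exact W.coeff_zetaOp_divX_mem_of_two_le h hT hk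

end PolynomialAlgebra

section PowerSeriesSide

open PowerSeries

variable {R : Type*} [CommRing R] (W : WeierstrassCurve R)

/-! ### The cleared evaluation `ev_d(g) = z^{2d}·g(x)` -/

/-- **`ev_d(g) = z^{2d}·g(x(z)) ∈ R⟦z⟧`** for a polynomial `g` of degree `≤ d`:
`Σ_k g_k X^k z^{2(d-k)}` with `X = z²x(z) = formalXMulSq` — the Laurent expansion of the
function `g(x)` with its pole of order `2d` at `O` cleared (evaluation of the homogenisation of
`g` at `(X, z²)`). [Blakestad–Grant 2023, §2 eq. (2) (the expansions at infinity in `t`)]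
[cite: BlakestadGrant2023, §2] -/
def clearedEval (d : ℕ) (g : Polynomial R) : R⟦X⟧ :=
  W.evalXZsq (g.homogenize d)

/-- `ev_d` is additive. [folklore] -/
theorem clearedEval_add (d : ℕ) (g h : Polynomial R) :
    W.clearedEval d (g + h) = W.clearedEval d g + W.clearedEval d h := by
  rw [clearedEval, Polynomial.homogenize_add, map_add]; rfl

/-- `ev_d` is subtractive. [folklore] -/
theorem clearedEval_sub (d : ℕ) (g h : Polynomial R) :
    W.clearedEval d (g - h) = W.clearedEval d g - W.clearedEval d h := by
  rw [clearedEval, Polynomial.homogenize_sub, map_sub]; rfl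

/-- `ev_d(0) = 0`. [folklore] -/
@[simp] theorem clearedEval_zero (d : ℕ) : W.clearedEval d 0 = 0 := by
  rw [clearedEval, Polynomial.homogenize_zero, map_zero]

/-- `ev_d` commutes with constants. [folklore] -/
theorem clearedEval_C_mul (d : ℕ) (c : R) (g : Polynomial R) :
    W.clearedEval d (Polynomial.C c * g) = C c * W.clearedEval d g := by
  rw [clearedEval, Polynomial.homogenize_C_mul, map_mul, evalXZsq_C]; rfl

/-- `ev_d(Σ gᵢ) = Σ ev_d(gᵢ)`. [folklore] -/
theorem clearedEval_sum {ι : Type*} (s : Finset ι) (g : ι → Polynomial R) (d : ℕ) :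
    W.clearedEval d (∑ i ∈ s, g i) = ∑ i ∈ s, W.clearedEval d (g i) := by
  rw [clearedEval, Polynomial.homogenize_finsetSum, map_sum]; rfl

/-- `ev_d(x^k) = X^k z^{2(d-k)}` for `k ≤ d`. [folklore] -/
theorem clearedEval_X_pow {k d : ℕ} (h : k ≤ d) :
    W.clearedEval d (Polynomial.X ^ k) = W.formalXMulSq ^ k * X ^ (2 * (d - k)) := by
  rw [clearedEval, Polynomial.homogenize_X_pow h, map_mul, map_pow, map_pow, evalXZsq_X_zero,
    evalXZsq_X_one, ← pow_mul, mul_comm 2]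

/-- `ev_d(c·x^k) = c·X^k z^{2(d-k)}` for `k ≤ d`. [folklore] -/
theorem clearedEval_C_mul_X_pow {k d : ℕ} (h : k ≤ d) (c : R) :
    W.clearedEval d (Polynomial.C c * Polynomial.X ^ k) =
      C c * (W.formalXMulSq ^ k * X ^ (2 * (d - k))) := by
  rw [clearedEval_C_mul, clearedEval_X_pow _ h]

/-- `ev` is multiplicative: `ev_{d+e}(g·h) = ev_d(g)·ev_e(h)` for `deg g ≤ d`, `deg h ≤ e`. [folklore] -/
theorem clearedEval_mul {d e : ℕ} {g h : Polynomial R} (hg : g.natDegree ≤ d) (hh : h.natDegree ≤ e) :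
    W.clearedEval (d + e) (g * h) = W.clearedEval d g * W.clearedEval e h := by
  rw [clearedEval, Polynomial.homogenize_mul _ _ hg hh, map_mul]; rfl

/-- Raising the level: `ev_{d+j}(g) = z^{2j}·ev_d(g)` for `deg g ≤ d`. [folklore] -/
theorem clearedEval_add_right {d : ℕ} (j : ℕ) {g : Polynomial R} (hg : g.natDegree ≤ d) :
    W.clearedEval (d + j) g = X ^ (2 * j) * W.clearedEval d g := by
  have := W.clearedEval_mul hg (show (1 : Polynomial R).natDegree ≤ j by simp)
  rw [mul_one] at this
  rw [this, clearedEval, clearedEval, Polynomial.homogenize_one, map_pow, evalXZsq_X_one, ← pow_mul,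
    mul_comm _ (X ^ (2 * j))]

/-- `ev₁(x) = X`. [folklore] -/
theorem clearedEval_X : W.clearedEval 1 Polynomial.X = W.formalXMulSq := by
  rw [← pow_one Polynomial.X, W.clearedEval_X_pow le_rfl, Nat.sub_self, mul_zero, pow_zero, mul_one,
    pow_one]

/-- `ev_{e+1}(x·g) = X·ev_e(g)` for `deg g ≤ e`. [folklore] -/
theorem clearedEval_X_mul {e : ℕ} {g : Polynomial R} (hg : g.natDegree ≤ e) :
    W.clearedEval (e + 1) (Polynomial.X * g) = W.formalXMulSq * W.clearedEval e g := by
  rw [add_comm, W.clearedEval_mul Polynomial.natDegree_X_le hg, clearedEval_X]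

/-- **Expansion**: `ev_d(g) = Σ_{k ≤ d} g_k · X^k z^{2(d-k)}` for `deg g ≤ d`. [folklore] -/
theorem clearedEval_eq_sum {d : ℕ} {g : Polynomial R} (hg : g.natDegree ≤ d) :
    W.clearedEval d g =
      ∑ k ∈ Finset.range (d + 1), C (g.coeff k) * (W.formalXMulSq ^ k * X ^ (2 * (d - k))) := by
  conv_lhs => rw [g.as_sum_range' (d + 1) (by omega), clearedEval_sum]
  refine Finset.sum_congr rfl fun k hk => ?_
  rw [← Polynomial.C_mul_X_pow_eq_monomial,
    W.clearedEval_C_mul_X_pow (Nat.lt_succ_iff.mp (Finset.mem_range.mp hk))]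

/-- Congruences pass through `ev`: if all coefficients of `g` lie in an ideal `I`, so do all
coefficients of `ev_d(g)`. [folklore] -/
theorem coeff_clearedEval_mem {I : Ideal R} {d : ℕ} {g : Polynomial R} (hg : g.natDegree ≤ d)
    (hI : ∀ k, g.coeff k ∈ I) (i : ℕ) : coeff i (W.clearedEval d g) ∈ I := by
  rw [W.clearedEval_eq_sum hg, map_sum]
  refine Submodule.sum_mem _ fun k _ => ?_
  rw [coeff_C_mul]
  exact Ideal.mul_mem_right _ _ (hI k)

/-- The constant term of `ev_d(g)` is the degree-`d` coefficient of `g` (`X(0) = 1`). [folklore] -/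
theorem constantCoeff_clearedEval {d : ℕ} {g : Polynomial R} (hg : g.natDegree ≤ d) :
    constantCoeff (W.clearedEval d g) = g.coeff d := by
  rw [W.clearedEval_eq_sum hg, map_sum, Finset.sum_eq_single_of_mem d (by simp)]
  · simp
  · intro k hk hkd
    have hk' : k < d := lt_of_le_of_ne (Nat.lt_succ_iff.mp (Finset.mem_range.mp hk)) hkd
    simp [zero_pow (show 2 * (d - k) ≠ 0 by omega)]

/-- `ev₃(f) = X³ + a₂z²X² + a₄z⁴X + a₆z⁶`. [folklore] -/
theorem clearedEval_rhsCubic :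
    W.clearedEval 3 W.rhsCubic = W.formalXMulSq ^ 3 + C W.a₂ * X ^ 2 * W.formalXMulSq ^ 2 +
      C W.a₄ * X ^ 4 * W.formalXMulSq + C W.a₆ * X ^ 6 := by
  rw [rhsCubic_eq, clearedEval_add, clearedEval_add, clearedEval_add,
    W.clearedEval_C_mul_X_pow le_rfl, W.clearedEval_C_mul_X_pow (by norm_num),
    W.clearedEval_C_mul_X_pow (by norm_num), W.clearedEval_C_mul_X_pow (by norm_num)]
  simp only [map_one, Nat.sub_self, mul_zero, pow_zero, mul_one, one_mul, pow_one,
    show 2 * (3 - 2) = 2 from rfl, show 2 * (3 - 1) = 4 from rfl, show 2 * (3 - 0) = 6 from rfl]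
  ring

/-- `ev₂(f') = 3X² + 2a₂z²X + a₄z⁴`. [folklore] -/
theorem clearedEval_derivative_rhsCubic :
    W.clearedEval 2 (Polynomial.derivative W.rhsCubic) =
      3 * W.formalXMulSq ^ 2 + 2 * C W.a₂ * X ^ 2 * W.formalXMulSq + C W.a₄ * X ^ 4 := by
  rw [derivative_rhsCubic, clearedEval_add, clearedEval_add, W.clearedEval_C_mul_X_pow le_rfl,
    W.clearedEval_C_mul_X_pow (by norm_num), W.clearedEval_C_mul_X_pow (by norm_num)]
  simp only [map_mul, Nat.sub_self, mul_zero, pow_zero, mul_one, pow_one,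
    show 2 * (2 - 1) = 2 from rfl, show 2 * (2 - 0) = 4 from rfl, map_ofNat]
  ring

section CharNeTwo

variable [W.IsCharNeTwoNF]

/-- The Weierstrass equation for `a₁ = a₃ = 0`: `X² = X³ + a₂z²X² + a₄z⁴X + a₆z⁶` (a private
copy of the identity of `PadicWeierstrassZetaProofs.lean`, to keep the imports independent).
[folklore] -/
private theorem formalXMulSq_sq_eq_of_isCharNeTwoNF' :
    W.formalXMulSq ^ 2 = W.formalXMulSq ^ 3 + C W.a₂ * X ^ 2 * W.formalXMulSq ^ 2 +
      C W.a₄ * X ^ 4 * W.formalXMulSq + C W.a₆ * X ^ 6 := by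
  have h := W.formalXMulSq_sq_eq
  rw [W.a₁_of_isCharNeTwoNF, W.a₃_of_isCharNeTwoNF, map_zero] at h
  linear_combination h

/-- `η·X = 3X² - 2X + 2a₂z²X + a₄z⁴` for `a₁ = a₃ = 0` (private copy, as above). [folklore] -/
private theorem formalEta_mul_formalXMulSq_of_isCharNeTwoNF' :
    W.formalEta * W.formalXMulSq = 3 * W.formalXMulSq ^ 2 - 2 * W.formalXMulSq +
      2 * C W.a₂ * X ^ 2 * W.formalXMulSq + C W.a₄ * X ^ 4 := by
  have h := W.formalEta_mul_formalXMulSq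
  rw [W.a₁_of_isCharNeTwoNF, W.a₃_of_isCharNeTwoNF, map_zero] at h
  linear_combination h

/-- **The Weierstrass equation, cleared: `ev₃(f) = X²`** (`z⁶f(x) = z⁶y² = (z³y)² = X²`).
[Silverman AEC IV.1] [folklore] -/
theorem clearedEval_rhsCubic_eq_sq : W.clearedEval 3 W.rhsCubic = W.formalXMulSq ^ 2 := by
  rw [clearedEval_rhsCubic]
  exact W.formalXMulSq_sq_eq_of_isCharNeTwoNF'.symm

/-- **`ev_{3m}(f^m) = X^{2m}`** (`z^{6m} f(x)^m = z^{6m} y^{2m}`). [folklore] -/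
theorem clearedEval_pow_rhsCubic (m : ℕ) :
    W.clearedEval (3 * m) (W.rhsCubic ^ m) = W.formalXMulSq ^ (2 * m) := by
  induction m with
  | zero =>
    rw [mul_zero, pow_zero, mul_zero, pow_zero, clearedEval, Polynomial.homogenize_one, pow_zero,
      map_one]
  | succ m ih =>
    rw [pow_succ, show 3 * (m + 1) = 3 * m + 3 by ring,
      W.clearedEval_mul (Polynomial.natDegree_pow_le.trans (by
        have := W.natDegree_rhsCubic_le; nlinarith)) W.natDegree_rhsCubic_le,
      ih, clearedEval_rhsCubic_eq_sq]
    ring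

/-- `η·(zX' - 2X) = -2X` for `a₁ = a₃ = 0` (`Dx = 2y`, `z³y = -X`). [folklore] -/
theorem formalEta_mul_sub_of_isCharNeTwoNF :
    W.formalEta * (X * d⁄dX R W.formalXMulSq - 2 * W.formalXMulSq) = -2 * W.formalXMulSq := by
  rw [W.formalEta_mul_sub_eq_formalYTilde, formalYTilde_def, W.a₁_of_isCharNeTwoNF,
    W.a₃_of_isCharNeTwoNF, map_zero, zero_mul, zero_sub, zero_mul, add_zero, neg_mul]

end CharNeTwo

/-! ### The invariant derivation with the pole cleared -/

/-- **`𝒟_M(F) = η·(zF' - M·F)`**: for the invariant derivation `D = d/ω = η·d/dz`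
(`formalInvariantDerivation`) and a Laurent series `z^{-M}F`, `F ∈ R⟦z⟧`, one has
`z^{M+1}·D(z^{-M}F) = η·(zF' - MF)`; so `𝒟_M` is `D` on functions with a pole of order `≤ M` at
`O`, poles cleared. [Blakestad–Grant 2023, §2 ("the derivation extends to the completed local
ring at infinity … and its fraction field")] [cite: BlakestadGrant2023, §2] -/
def clearedDeriv (M : ℕ) (F : R⟦X⟧) : R⟦X⟧ :=
  W.formalEta * (X * d⁄dX R F - (M : R⟦X⟧) * F)

/-- Unfolding `clearedDeriv`. [folklore] -/
theorem clearedDeriv_def (M : ℕ) (F : R⟦X⟧) :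
    W.clearedDeriv M F = W.formalEta * (X * d⁄dX R F - (M : R⟦X⟧) * F) := rfl

/-- `𝒟₀ = z·D`. [folklore] -/
theorem clearedDeriv_zero_eq (F : R⟦X⟧) : W.clearedDeriv 0 F = X * W.formalInvariantDerivation F := by
  rw [clearedDeriv, formalInvariantDerivation_apply, Nat.cast_zero, zero_mul, sub_zero]; ring

/-- `𝒟_M` is additive. [folklore] -/
theorem clearedDeriv_add (M : ℕ) (F G : R⟦X⟧) :
    W.clearedDeriv M (F + G) = W.clearedDeriv M F + W.clearedDeriv M G := by
  simp only [clearedDeriv, map_add]; ring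

/-- `𝒟_M` is subtractive. [folklore] -/
theorem clearedDeriv_sub (M : ℕ) (F G : R⟦X⟧) :
    W.clearedDeriv M (F - G) = W.clearedDeriv M F - W.clearedDeriv M G := by
  simp only [clearedDeriv, map_sub]; ring

/-- `𝒟_M` commutes with constants. [folklore] -/
theorem clearedDeriv_C_mul (M : ℕ) (c : R) (F : R⟦X⟧) :
    W.clearedDeriv M (C c * F) = C c * W.clearedDeriv M F := by
  simp only [clearedDeriv, Derivation.leibniz, derivative_C, smul_eq_mul]; ring

/-- `𝒟_M(-F) = -𝒟_M(F)`. [folklore] -/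
theorem clearedDeriv_neg (M : ℕ) (F : R⟦X⟧) : W.clearedDeriv M (-F) = -W.clearedDeriv M F := by
  simp only [clearedDeriv, map_neg]; ring

/-- `𝒟_M(Σ Fᵢ) = Σ 𝒟_M(Fᵢ)`. [folklore] -/
theorem clearedDeriv_sum {ι : Type*} (s : Finset ι) (F : ι → R⟦X⟧) (M : ℕ) :
    W.clearedDeriv M (∑ i ∈ s, F i) = ∑ i ∈ s, W.clearedDeriv M (F i) := by
  classical
  induction s using Finset.induction_on with
  | empty => simp [clearedDeriv]
  | insert a s ha ih => rw [Finset.sum_insert ha, Finset.sum_insert ha, clearedDeriv_add, ih]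

/-- `𝒟_M(1) = -M·η` (`D(z^{-M}) = -M z^{-M-1}·Dz`, `Dz = η`). [folklore] -/
theorem clearedDeriv_one (M : ℕ) : W.clearedDeriv M 1 = -(M : R⟦X⟧) * W.formalEta := by
  rw [clearedDeriv, Derivation.map_one_eq_zero, mul_zero, zero_sub, mul_one]; ring

/-- Shifting the level by one: `𝒟_{M+1}(z·F) = z·𝒟_M(F)`. [folklore] -/
theorem clearedDeriv_X_mul (M : ℕ) (F : R⟦X⟧) :
    W.clearedDeriv (M + 1) (X * F) = X * W.clearedDeriv M F := by
  simp only [clearedDeriv, Derivation.leibniz, derivative_X, smul_eq_mul, mul_one, Nat.cast_succ]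
  ring

/-- **Shifting the level: `𝒟_{M+j}(z^j·F) = z^j·𝒟_M(F)`** (the same function `z^{-M}F` written at a
higher level). [folklore] -/
theorem clearedDeriv_X_pow_mul (M j : ℕ) (F : R⟦X⟧) :
    W.clearedDeriv (M + j) (X ^ j * F) = X ^ j * W.clearedDeriv M F := by
  induction j with
  | zero => rw [add_zero, pow_zero, one_mul, one_mul]
  | succ j ih => rw [← add_assoc, pow_succ', mul_assoc, clearedDeriv_X_mul, ih, mul_assoc]

/-- `(F^{k+1})' = (k+1)·F^k·F'`. [folklore] -/
theorem _root_.Literature.NumberTheory.EllipticCurves.powerSeries_derivative_pow_succ (F : R⟦X⟧) (k : ℕ) :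
    d⁄dX R (F ^ (k + 1)) = ((k : R⟦X⟧) + 1) * F ^ k * d⁄dX R F := by
  induction k with
  | zero => simp
  | succ k ih =>
    rw [pow_succ, Derivation.leibniz, ih, smul_eq_mul, smul_eq_mul]
    push_cast
    ring

section CharNeTwo

variable [W.IsCharNeTwoNF]

/-- **`D(y·x^k) = L(x^k)`**, poles cleared: `𝒟_{2k+3}(X^{k+1}) = -ev_{k+2}(L(x^k))`
(`y x^k` has a pole of order `2k+3` and `z^{2k+3} y x^k = -X^{k+1}`). [Blakestad–Grant 2023, §2
(`Dx = 2y`, `Dy = f'(x)`)] [folklore] -/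
theorem clearedDeriv_formalXMulSq_pow (k : ℕ) :
    W.clearedDeriv (2 * k + 3) (W.formalXMulSq ^ (k + 1)) =
      -W.clearedEval (k + 2) (W.zetaOp (Polynomial.X ^ k)) := by
  have hY := W.formalEta_mul_sub_of_isCharNeTwoNF
  have hR3 := W.formalEta_mul_formalXMulSq_of_isCharNeTwoNF'
  set Xs := W.formalXMulSq with hXs
  rcases k with _ | j
  · -- `k = 0`: `𝒟₃(X) = -ev₂(f')`
    rw [pow_zero, show W.zetaOp 1 = Polynomial.derivative W.rhsCubic by simp [zetaOp_def],
      clearedEval_derivative_rhsCubic, clearedDeriv, zero_add, pow_one]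
    push_cast
    linear_combination hY - hR3
  · -- `k = j + 1`
    rw [zetaOp_X_pow_succ, clearedEval_add,
      show (2 * ((j : Polynomial R) + 1) * W.rhsCubic * Polynomial.X ^ j) =
        Polynomial.C (2 * ((j : R) + 1)) * (W.rhsCubic * Polynomial.X ^ j) by
          simp only [map_mul, map_add, map_natCast, map_one, map_ofNat]; ring,
      clearedEval_C_mul, show j + 1 + 2 = 3 + j by ring,
      W.clearedEval_mul W.natDegree_rhsCubic_le (Polynomial.natDegree_X_pow_le j),
      show 3 + j = 2 + (j + 1) by ring,
      W.clearedEval_mul W.natDegree_derivative_rhsCubic_le (Polynomial.natDegree_X_pow_le (j + 1)),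
      clearedEval_derivative_rhsCubic, clearedEval_rhsCubic_eq_sq, W.clearedEval_X_pow le_rfl,
      W.clearedEval_X_pow le_rfl, clearedDeriv,
      Literature.NumberTheory.EllipticCurves.powerSeries_derivative_pow_succ]
    simp only [Nat.sub_self, mul_zero, pow_zero, mul_one, map_mul, map_add, map_natCast, map_one,
      map_ofNat]
    push_cast
    linear_combination (↑j + 2) * Xs ^ (j + 1) * hY - Xs ^ (j + 1) * hR3

/-- **`D(y·g(x)) = L(g) = f'g + 2fg'`**, poles cleared: for `deg g ≤ e`,
`𝒟_{2e+3}(ev_{e+1}(x·g)) = -ev_{e+2}(L(g))` (note `z^{2e+3}·y·g(x) = -ev_{e+1}(x g)`).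
[Blakestad–Grant 2023, §2 ("the unique derivation such that `Dx = 2y`")]
[cite: BlakestadGrant2023, §2] -/
theorem clearedDeriv_clearedEval {e : ℕ} {g : Polynomial R} (hg : g.natDegree ≤ e) :
    W.clearedDeriv (2 * e + 3) (W.clearedEval (e + 1) (Polynomial.X * g)) =
      -W.clearedEval (e + 2) (W.zetaOp g) := by
  have hsum := g.as_sum_range' (e + 1) (by omega)
  rw [hsum, Finset.mul_sum, clearedEval_sum, clearedDeriv_sum, zetaOp_sum, clearedEval_sum,
    ← Finset.sum_neg_distrib]
  refine Finset.sum_congr rfl fun k hk => ?_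
  have hk' : k ≤ e := Nat.lt_succ_iff.mp (Finset.mem_range.mp hk)
  rw [← Polynomial.C_mul_X_pow_eq_monomial, ← mul_assoc, Polynomial.X_mul_C, mul_assoc, ← pow_succ',
    W.clearedEval_C_mul_X_pow (by omega), show e + 1 - (k + 1) = e - k by omega, clearedDeriv_C_mul,
    mul_comm (W.formalXMulSq ^ (k + 1)), show 2 * e + 3 = (2 * k + 3) + 2 * (e - k) by omega,
    clearedDeriv_X_pow_mul, clearedDeriv_formalXMulSq_pow, zetaOp_C_mul, clearedEval_C_mul,
    show e + 2 = (k + 2) + (e - k) by omega,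
    W.clearedEval_add_right (e - k) ((W.natDegree_zetaOp_le _).trans
      (by have := Polynomial.natDegree_X_pow_le (R := R) k; omega))]
  ring

end CharNeTwo

/-! ### The approximants: `T_N`, `Q_N`, and `H_N·tζ_N` -/

/-- **`T_N`** (`N = 2m+1`): the truncation of `f(x)^m` below degree `N`, so that
`H_N·ζ_N = -y·T_N(x)/x^N` is Blakestad–Grant's `ζ_n = H_n⁻¹(t^{-pⁿ} - z_n)` times `H_n`
(`[x^{N-1}]T_N = H_N`, `[x^{N-2}]T_N = J_N`). [Blakestad–Grant 2023, Prop. 3(b)]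
[cite: BlakestadGrant2023, Prop. 3] -/
def zetaRem (m : ℕ) : Polynomial R :=
  (W.rhsCubic ^ m) %ₘ Polynomial.X ^ (2 * m + 1)

/-- **`Q_N`** (`N = 2m+1`): the quotient of `f(x)^m` by `x^N`, so that Blakestad–Grant's
`z_N ∈ L(N·O)` is `-y·Q_N(x)` (since `t^{-N} = -y f^m/x^N`). [Blakestad–Grant 2023, Prop. 3(a)]
[cite: BlakestadGrant2023, Prop. 3] -/
def zetaQuot (m : ℕ) : Polynomial R :=
  (W.rhsCubic ^ m) /ₘ Polynomial.X ^ (2 * m + 1)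

/-- **`H_N·t·ζ_N = B^{N-1}·ev_{N-1}(T_N)`** (`N = 2m + 1`, `B = w/z³ = X⁻¹`): the approximant of
the `p`-adic Weierstrass zeta function with its simple pole cleared and scaled by `H_N`
(`ζ_N = -H_N⁻¹ y T_N(x)/x^N = H_N⁻¹ t⁻¹ Σ_{j<N} [x^j]f^m · x^{j+1-N}`). [Blakestad–Grant 2023,
Prop. 3(b) (`ζ_n := H_n⁻¹(t^{-pⁿ} - z_n) ∈ (1/t)R̂⟦t⟧`)] [cite: BlakestadGrant2023, Prop. 3] -/
def zetaApproxNum (m : ℕ) : R⟦X⟧ :=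
  W.formalWDivCube ^ (2 * m) * W.clearedEval (2 * m) (W.zetaRem m)

/-- `f^m = T_N + x^N·Q_N`. [folklore] -/
theorem zetaRem_add_X_pow_mul_zetaQuot (m : ℕ) :
    W.zetaRem m + Polynomial.X ^ (2 * m + 1) * W.zetaQuot m = W.rhsCubic ^ m :=
  Polynomial.modByMonic_add_div _ _

/-- `deg T_N ≤ N - 1`. [folklore] -/
theorem natDegree_zetaRem_le (m : ℕ) : (W.zetaRem m).natDegree ≤ 2 * m := by
  rcases subsingleton_or_nontrivial R with hR | hR
  · rw [Subsingleton.elim (W.zetaRem m) 0, Polynomial.natDegree_zero]; exact Nat.zero_le _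
  · have h := Polynomial.natDegree_modByMonic_lt (W.rhsCubic ^ m) (Polynomial.monic_X_pow (2 * m + 1))
      (by
        intro h1
        have := congrArg Polynomial.natDegree h1
        rw [Polynomial.natDegree_X_pow, Polynomial.natDegree_one] at this
        omega)
    rw [Polynomial.natDegree_X_pow] at h
    exact Nat.lt_succ_iff.mp h

/-- `deg Q_N ≤ m - 1` (`deg f^m ≤ 3m`, `N = 2m + 1`). [folklore] -/
theorem natDegree_zetaQuot_le (m : ℕ) : (W.zetaQuot m).natDegree ≤ m - 1 := by
  rcases subsingleton_or_nontrivial R with hR | hR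
  · rw [Subsingleton.elim (W.zetaQuot m) 0, Polynomial.natDegree_zero]; exact Nat.zero_le _
  rw [zetaQuot, Polynomial.natDegree_divByMonic _ (Polynomial.monic_X_pow _), Polynomial.natDegree_X_pow]
  have : (W.rhsCubic ^ m).natDegree ≤ 3 * m :=
    Polynomial.natDegree_pow_le.trans (by have := W.natDegree_rhsCubic_le; nlinarith)
  omega

/-- `[x^j] T_N = [x^j] f^m` for `j < N`. [folklore] -/
theorem coeff_zetaRem {m j : ℕ} (hj : j < 2 * m + 1) : (W.zetaRem m).coeff j = (W.rhsCubic ^ m).coeff j :=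
  Literature.NumberTheory.EllipticCurves.coeff_eq_of_add_X_pow_mul (W.zetaRem_add_X_pow_mul_zetaQuot m) hj

/-- **`(H_N tζ_N)(0) = H_N = [x^{N-1}] f^m`** — the residue of `ζ_N` is `1`. [Blakestad–Grant 2023,
Prop. 3(b), Thm. 2 (`ζ ∈ 1/t + R̂⟦t⟧`)] [cite: BlakestadGrant2023, Prop. 3] -/
theorem constantCoeff_zetaApproxNum (m : ℕ) :
    constantCoeff (W.zetaApproxNum m) = (W.rhsCubic ^ m).coeff (2 * m) := by
  rw [zetaApproxNum, map_mul, map_pow, constantCoeff_formalWDivCube, one_pow, one_mul,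
    W.constantCoeff_clearedEval (W.natDegree_zetaRem_le m), W.coeff_zetaRem (by omega)]

section CharNeTwo

variable [W.IsCharNeTwoNF]

/-- **`t^{-N} - z_N = H_N·ζ_N`, poles cleared: `1 - ev_m(x·Q_N) = z^{N-1}·(H_N tζ_N)`.** Here
`ev_m(x Q_N) = z^N·z_N` (`z_N = -yQ_N(x)`, `z³y = -X`) and `z^N·t^{-N} = 1`; the identity is
`f^m = T_N + x^NQ_N` evaluated at `x(z)` and cleared (`ev_{3m}(f^m) = X^{2m}`).
[Blakestad–Grant 2023, Prop. 3(a)(b)] [cite: BlakestadGrant2023, Prop. 3] -/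
theorem one_sub_clearedEval_eq {m : ℕ} (hm : 1 ≤ m) :
    1 - W.clearedEval m (Polynomial.X * W.zetaQuot m) = X ^ (2 * m) * W.zetaApproxNum m := by
  obtain ⟨e, rfl⟩ : ∃ e, m = e + 1 := ⟨m - 1, by omega⟩
  have hT := W.natDegree_zetaRem_le (e + 1)
  have hQ : (W.zetaQuot (e + 1)).natDegree ≤ e := by
    have := W.natDegree_zetaQuot_le (e + 1); rwa [Nat.add_sub_cancel] at this
  have hBX := W.formalWDivCube_mul_formalXMulSq
  have key := W.clearedEval_pow_rhsCubic (e + 1)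
  rw [← W.zetaRem_add_X_pow_mul_zetaQuot (e + 1), clearedEval_add,
    show 3 * (e + 1) = 2 * (e + 1) + (e + 1) by ring, W.clearedEval_add_right (e + 1) hT,
    show 2 * (e + 1) + (e + 1) = (2 * (e + 1) + 1) + e by ring,
    W.clearedEval_mul (Polynomial.natDegree_X_pow_le _) hQ, W.clearedEval_X_pow le_rfl] at key
  rw [zetaApproxNum, W.clearedEval_X_mul hQ]
  simp only [Nat.sub_self, mul_zero, pow_zero, mul_one] at key
  set B := W.formalWDivCube
  set Xs := W.formalXMulSq
  set EQ := W.clearedEval e (W.zetaQuot (e + 1))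
  set ET := W.clearedEval (2 * (e + 1)) (W.zetaRem (e + 1))
  have hBXpow : B ^ (2 * (e + 1)) * Xs ^ (2 * (e + 1)) = 1 := by rw [← mul_pow, hBX, one_pow]
  have hsplit : Xs ^ (2 * (e + 1) + 1) = Xs ^ (2 * (e + 1)) * Xs := pow_succ _ _
  rw [hsplit] at key
  linear_combination (-(B ^ (2 * (e + 1)))) * key - (1 - Xs * EQ) * hBXpow

/-- **Blakestad–Grant's Prop. 3(c), explicit and pole-cleared:
`𝒟₁(H_N tζ_N) ≡ J_N·z² - H_N·X (mod N)`**, i.e. `D ζ_N ≡ -x + β_N (mod N)` with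
`β_N = J_N/H_N`, `H_N = [x^{N-1}]f^m`, `J_N = [x^{N-2}]f^m` (`N = 2m + 1 ≥ 3`, `a₁ = a₃ = 0`; every
coefficient of the difference lies in `N·R`). Proof: apply `𝒟_N` to
`1 - ev_m(xQ_N) = z^{N-1}(H_N tζ_N)`; `𝒟_N(1) = -Nη`, `𝒟_N(ev_m(xQ_N)) = -ev_{m+1}(L Q_N)` and
`L(Q_N) ≡ J_N - H_N x (mod N)`. [Blakestad–Grant 2023, Prop. 3(c) ("`D(ζ_n) ≡ -x + β_n mod pⁿ`
for `β_n = J_n/H_n`")] [cite: BlakestadGrant2023, Prop. 3] -/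
theorem coeff_clearedDeriv_zetaApproxNum_sub_mem {m : ℕ} (hm : 1 ≤ m) (i : ℕ) :
    coeff i (W.clearedDeriv 1 (W.zetaApproxNum m) -
      (C ((W.rhsCubic ^ m).coeff (2 * m - 1)) * X ^ 2 -
        C ((W.rhsCubic ^ m).coeff (2 * m)) * W.formalXMulSq)) ∈ Ideal.span {(2 * (m : R) + 1)} := by
  obtain ⟨e, rfl⟩ : ∃ e, m = e + 1 := ⟨m - 1, by omega⟩
  have hT := W.natDegree_zetaRem_le (e + 1)
  have hQ : (W.zetaQuot (e + 1)).natDegree ≤ e := by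
    have := W.natDegree_zetaQuot_le (e + 1); rwa [Nat.add_sub_cancel] at this
  set I : Ideal R := Ideal.span {(2 * ((e + 1 : ℕ) : R) + 1)} with hI
  set H := (W.rhsCubic ^ (e + 1)).coeff (2 * (e + 1))
  set J := (W.rhsCubic ^ (e + 1)).coeff (2 * (e + 1) - 1)
  -- the polynomial `P = L(Q) - (J - Hx)` has coefficients in `N·R` and degree `≤ m + 1`
  set P : Polynomial R := W.zetaOp (W.zetaQuot (e + 1)) - (Polynomial.C J - Polynomial.C H * Polynomial.X)
    with hP
  have hPmem : ∀ k, P.coeff k ∈ I := fun k =>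
    W.coeff_zetaOp_divX_sub_mem hm (W.zetaRem_add_X_pow_mul_zetaQuot (e + 1)) hT k
  have hPdeg : P.natDegree ≤ e + 2 := by
    refine (Polynomial.natDegree_sub_le _ _).trans (max_le ((W.natDegree_zetaOp_le _).trans (by omega)) ?_)
    refine (Polynomial.natDegree_sub_le _ _).trans (max_le (by simp) ?_)
    exact (Polynomial.natDegree_C_mul_le _ _).trans (Polynomial.natDegree_X_le.trans (by omega))
  -- `ev_{m+1}(J - Hx) = z^{N-1}·(Jz² - HX)`
  have hev : W.clearedEval (e + 2) (Polynomial.C J - Polynomial.C H * Polynomial.X) =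
      X ^ (2 * (e + 1)) * (C J * X ^ 2 - C H * W.formalXMulSq) := by
    rw [clearedEval_sub, show (Polynomial.C J : Polynomial R) = Polynomial.C J * Polynomial.X ^ 0 by
        rw [pow_zero, mul_one],
      show Polynomial.C H * Polynomial.X = Polynomial.C H * Polynomial.X ^ 1 by rw [pow_one],
      W.clearedEval_C_mul_X_pow (Nat.zero_le _), W.clearedEval_C_mul_X_pow (by omega), pow_zero,
      one_mul, pow_one, show 2 * (e + 2 - 0) = 2 * (e + 1) + 2 by omega,
      show 2 * (e + 2 - 1) = 2 * (e + 1) by omega, pow_add]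
    ring
  -- apply `𝒟_N` to `1 - ev_m(xQ) = z^{N-1}·G`
  have key := congrArg (W.clearedDeriv (2 * (e + 1) + 1)) (W.one_sub_clearedEval_eq hm)
  rw [clearedDeriv_sub, clearedDeriv_one, show 2 * (e + 1) + 1 = 2 * e + 3 by ring,
    W.clearedDeriv_clearedEval hQ, show 2 * e + 3 = 1 + 2 * (e + 1) by ring, clearedDeriv_X_pow_mul,
    show W.zetaOp (W.zetaQuot (e + 1)) = P + (Polynomial.C J - Polynomial.C H * Polynomial.X) by
      rw [hP]; ring,
    clearedEval_add, hev] at key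
  -- so `z^{N-1}·(𝒟₁G - (Jz² - HX)) = ev(P) - Nη`, all of whose coefficients lie in `N·R`
  have hE : X ^ (2 * (e + 1)) * (W.clearedDeriv 1 (W.zetaApproxNum (e + 1)) -
      (C J * X ^ 2 - C H * W.formalXMulSq)) =
        W.clearedEval (e + 2) P - ((1 + 2 * (e + 1) : ℕ) : R⟦X⟧) * W.formalEta := by
    linear_combination -key
  have hcoeff : coeff (i + 2 * (e + 1)) (X ^ (2 * (e + 1)) *
      (W.clearedDeriv 1 (W.zetaApproxNum (e + 1)) - (C J * X ^ 2 - C H * W.formalXMulSq))) ∈ I := by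
    rw [hE, map_sub]
    refine Submodule.sub_mem _ (W.coeff_clearedEval_mem hPdeg hPmem _) ?_
    rw [show (((1 + 2 * (e + 1) : ℕ) : R⟦X⟧)) = C (2 * ((e + 1 : ℕ) : R) + 1) by
      simp only [map_add, map_mul, map_natCast, map_one, map_ofNat]; push_cast; ring, coeff_C_mul]
    exact Ideal.mul_mem_right _ _ (Ideal.subset_span rfl)
  rwa [coeff_X_pow_mul] at hcoeff

/-! ### Parity: `H_N tζ_N` is even (so `ζ_N` is odd) -/

/-- `rescale a (C c) = C c` (private copy of a generic lemma of `PadicWeierstrassZetaProofs.lean`).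
[folklore] -/
private theorem rescale_C_eq' (a c : R) : rescale a (C c) = C c := by
  ext n
  rw [coeff_rescale, coeff_C]
  split_ifs with h
  · rw [h, pow_zero, one_mul]
  · rw [mul_zero]

/-- `(-z)^{2j} = z^{2j}` (private copy, as above). [folklore] -/
private theorem rescale_neg_one_X_pow_two_mul' (j : ℕ) :
    rescale (-1 : R) ((X : R⟦X⟧) ^ (2 * j)) = X ^ (2 * j) := by
  rw [map_pow, rescale_X, mul_pow, ← map_pow, pow_mul, neg_one_sq, one_pow, map_one, one_mul]

/-- **`B = w/z³ = 1/X` is even** for `a₁ = a₃ = 0`. [Silverman AEC IV.1] [folklore] -/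
theorem rescale_neg_one_formalWDivCube : rescale (-1 : R) W.formalWDivCube = W.formalWDivCube := by
  have hBX := W.formalWDivCube_mul_formalXMulSq
  have h := congrArg (rescale (-1 : R)) hBX
  rw [map_mul, map_one, W.rescale_neg_one_formalXMulSq] at h
  calc rescale (-1 : R) W.formalWDivCube
      = rescale (-1 : R) W.formalWDivCube * (W.formalWDivCube * W.formalXMulSq) := by rw [hBX, mul_one]
    _ = (rescale (-1 : R) W.formalWDivCube * W.formalXMulSq) * W.formalWDivCube := by ring
    _ = W.formalWDivCube := by rw [h, one_mul]

/-- `ev_d(g)` is even (it is a polynomial in `X` and `z²`). [folklore] -/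
theorem rescale_neg_one_clearedEval {d : ℕ} {g : Polynomial R} (hg : g.natDegree ≤ d) :
    rescale (-1 : R) (W.clearedEval d g) = W.clearedEval d g := by
  rw [W.clearedEval_eq_sum hg, map_sum]
  refine Finset.sum_congr rfl fun k _ => ?_
  rw [map_mul, map_mul, map_pow, rescale_C_eq', W.rescale_neg_one_formalXMulSq,
    rescale_neg_one_X_pow_two_mul']

/-- **`H_N tζ_N` is even, i.e. `ζ_N` is odd** ("its uniqueness makes `z_n` odd").
[Blakestad–Grant 2023, Prop. 3(a), Thm. 2] [cite: BlakestadGrant2023, Prop. 3] -/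
theorem rescale_neg_one_zetaApproxNum (m : ℕ) :
    rescale (-1 : R) (W.zetaApproxNum m) = W.zetaApproxNum m := by
  rw [zetaApproxNum, map_mul, map_pow, rescale_neg_one_formalWDivCube,
    W.rescale_neg_one_clearedEval (W.natDegree_zetaRem_le m)]

end CharNeTwo

end PowerSeriesSide

end WeierstrassCurve
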